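import Summits.HodgeConjecture.HodgeCM.Model.TowerAlgebra
import Literature.NumberTheory.Automorphic.SmoothRepresentation
import Literature.NumberTheory.Automorphic.Liu2021.Def411AsPrinted
import Literature.RepresentationTheory.Semisimple.EquivariantIrreducibleDecomposition
import HarnessLib

/-!
# The tower `H = colim_K H¹(X_K(ℂ); ℂ)` is a SMOOTH representation of `U(V)(𝔸_{L₀,f})`

Fan A, binder `h413` ([Liu 2021, Prop. 4.13]), analytic half — the part of «`H¹_{B,τ'}(A_∞, ℂ)` is an admissible representation»
(Liu l. 2081) that the tree's tower already carries: every vector of the PIN's `Tower … V` (`Model/TowerCarrier`) comes from a finite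
level `H_K` (`exists_ofLevel`) and is fixed by the compact open `K` (`act_ofLevel_of_mem`), so its stabiliser is open.

* `towerRep_isSmooth` — `(towerRep … V).IsSmooth` (tree predicate `Representation.IsSmooth`: open stabilisers);
* `isSmoothRep_towerRep` — the same in the vocabulary of [Liu2021, Def. 4.11] (`Liu2021.IsSmoothRep`);
* `ofModule'_tower_eq_towerRep` — the representation `Representation.ofModule'` of the `ℂ[U(V)(𝔸_f)]`-MODULE `Tower … V`
  (`Model/TowerAlgebra`; this is `P.rhoB τ'` of the `h413` datum `𝕌_V.prop413Data H`) IS `towerRep`; hence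
  `isSmoothRep_ofModule'_tower`, `isSmooth_ofModule'_tower`.

HC_CM is proved only modulo the 7 printed citations until rung 0 closes; this file discharges none of them.
-/

noncomputable section

open NumberField
open Literature.AlgebraicGeometry.HodgeTheory
open Literature.NumberTheory.Automorphic
open Literature.NumberTheory.Automorphic.PicardCM
open Literature.NumberTheory.Transcendental (Arapura2012_Cor_15_4_6)

namespace HodgeCM.Model.TowerCarrier

variable (hHD : exists_isReal_hodgeModel) (hI : hodgePQ_independent_of_hodgeModel)
  (hU : BallQuotientUniformisedDatum) (h₃ : CMAbelianVarietyRealised) (hA : Arapura2012_Cor_15_4_6)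
variable {L : CMField} {ι₁ : L →+* ℂ} (V : HermSpace3 L ι₁)

/-- **The tower is a smooth representation**: the stabiliser of every `x ∈ H = colim_K H_K` is open, because `x = [c]` for some
`c ∈ H_K` and `K` (compact OPEN) fixes it. [cite: Liu2021, §4.2 l. 2079–2081] -/
theorem towerRep_isSmooth :
    Representation.IsSmooth (k := ℂ) (G := ↥V.adelicFin) (V := Tower hHD hI hU h₃ hA V) (towerRep hHD hI hU h₃ hA V) := by
  intro x
  obtain ⟨Γ, hΓ, c, rfl⟩ := exists_ofLevel hHD hI hU h₃ hA x
  refine Representation.isSmoothVector_of_le (k := ℂ) (G := ↥V.adelicFin) (V := Tower hHD hI hU h₃ hA V)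
    (towerRep hHD hI hU h₃ hA V) Γ.isOpen_K fun k hk => ?_
  exact towerRep_ofLevel_of_mem hHD hI hU h₃ hA hΓ hk c

/-- The same in the vocabulary of [Liu2021, Def. 4.11]: every vector of the tower is fixed by an open subgroup of `U(V)(𝔸_{L₀,f})`.
[cite: Liu2021, §4.2 l. 2079–2081, Def. 4.11] -/
theorem isSmoothRep_towerRep :
    Liu2021.IsSmoothRep (G := ↥V.adelicFin) (V := Tower hHD hI hU h₃ hA V) (towerRep hHD hI hU h₃ hA V) := by
  intro x
  obtain ⟨Γ, hΓ, c, rfl⟩ := exists_ofLevel hHD hI hU h₃ hA x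
  exact ⟨Γ.K, Γ.isOpen_K, fun k hk => towerRep_ofLevel_of_mem hHD hI hU h₃ hA hΓ hk c⟩

/-- The representation `ofModule'` of the `ℂ[U(V)(𝔸_f)]`-module `Tower … V` (`Model/TowerAlgebra`) — this is the field `rhoB τ'` of the
`h413` datum `𝕌_V.prop413Data H` — IS `towerRep`. [folklore] -/
theorem ofModule'_tower_eq_towerRep :
    @Representation.ofModule' ℂ ↥V.adelicFin _ _ (Tower hHD hI hU h₃ hA V) (AddCommGroup.toAddCommMonoid) _ _ _ =
      towerRep hHD hI hU h₃ hA V := by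
  refine MonoidHom.ext fun g => LinearMap.ext fun x => ?_
  have h := Literature.RepresentationTheory.Semisimple.ofModule'_apply_eq_of_smul (k := ℂ) (G := ↥V.adelicFin)
    (Tower hHD hI hU h₃ hA V) g x
  rw [of_smul_eq_act] at h
  exact h

/-- Hence `rhoB τ'` of the `h413` datum is smooth (tree predicate). [cite: Liu2021, §4.2 l. 2079–2081] -/
theorem isSmooth_ofModule'_tower :
    Representation.IsSmooth (k := ℂ) (G := ↥V.adelicFin) (V := Tower hHD hI hU h₃ hA V)
      (Representation.ofModule' (k := ℂ) (G := ↥V.adelicFin) (Tower hHD hI hU h₃ hA V)) := by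
  rw [ofModule'_tower_eq_towerRep]
  exact towerRep_isSmooth hHD hI hU h₃ hA V

/-- Hence `rhoB τ'` of the `h413` datum is smooth ([Liu2021, Def. 4.11] vocabulary). [cite: Liu2021, §4.2 l. 2079–2081, Def. 4.11] -/
theorem isSmoothRep_ofModule'_tower :
    Liu2021.IsSmoothRep (G := ↥V.adelicFin) (V := Tower hHD hI hU h₃ hA V)
      (Representation.ofModule' (k := ℂ) (G := ↥V.adelicFin) (Tower hHD hI hU h₃ hA V)) := by
  rw [ofModule'_tower_eq_towerRep]
  exact isSmoothRep_towerRep hHD hI hU h₃ hA V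

end HodgeCM.Model.TowerCarrier

end
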